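import Summits.BirchSwinnertonDyer.Rank1Residual.GaloisImage.TwoLagrangianLinesLocal
import Summits.BirchSwinnertonDyer.Rank1Residual.Additive.KummerVersusUnramifiedLocal
import HarnessLib

/-!
# The PAIR RULE at a tame place with one rational line of `p`-torsion (route planner 1's L44 /
# ST-44a): unramified/unramified ⇒ the Kummer lines CORRESPOND, unramified/inertia-torsion ⇒ they
# are TRANSVERSE (cell `b2b-bsdres`, team n1011, row T-2LL "two Lagrangian lines", FILE 4 = ST-44a
# dealt by the lead R5-87; seat p04 GEN 11; skeleton `cells/n1011/skel/T-2LL.md`)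

HONEST FRAMING (cell `b2b-bsdres`, run/shared/lean/b2b/bsd-rank1-residual/, verbatim in every
file): the goal of the cell is to DELETE the COMBINATION-SHAPED residual classes of the
Birch–Swinnerton-Dyer formula for ALL analytic-rank `≤ 1` elliptic curves over `ℚ` — "full BSD
formula for every rank `≤ 1` curve in class `C`" assembled STRICTLY from published theorems — so
that the rank-`≤ 1` remainder becomes exactly the CONSTRUCTION-SHAPED classes, which are TYPED
(missing-input `Prop`s), NOT attempted. This is not "finishing BSD". Team n1011 (N10 / N11, the
additive block X4 ∧ `p = 3`): research route on the CONSTRUCTION-SHAPED class X4; no claim beyond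
the stated classes; nothing is booked; no mark / label / count is changed by this file. Theorems
only (no definition, no named fact, no `sorry`); no named-fact hypothesis. TOOL theorems: they make
route planner 1's per-place "cost" readings EXACT in the kernel; they close nothing; every count
quoted from ROUTE-1 §44 ('paid-exact 2 167 places', parity audits) is EVIDENCE.

## What (ROUTE-1 §44, L44: "at `v ∤ 3` with `dim E[3]^{G_v} = 1` … the Kummer line of a curve is
## `H¹_nr` or the other isotropic line `Λ_v`; pair rule `d_v = 0` iff both on the same side, else
## EXACTLY `1`")

At a finite place `v ∤ p` the unramified subgroup `U = H¹_ur(K_v, E[p])` and the local Kummer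
condition `𝓛 = 𝓛_v(E)` have the SAME order `#E(K_v)[p]`
(`natCard_unramifiedSubgroup_eq_natCard_kummerLocalConditionAt`, p16 / p06), so a curve is of exactly
one of two TYPES at `v`: **U-type** `U ≤ 𝓛` (then `U = 𝓛`: e.g. good reduction, non-split
multiplicative with `p` odd, split multiplicative with `p ∤ c_v`) or **Λ-type** `U ⊓ 𝓛 = ⊥`, which
follows from the inertia-torsion hypothesis `hI` of `Additive.UnramifiedKummerDisjoint` (true at every
ADDITIVE `v ∤ p`, `p` odd). For `p`-congruent `E`, `E′` (`θ : E′[p] ≃ E[p]`, `f` its restriction to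
`Γ_{K_v}`) this file proves, with NO pairing and NO count hypothesis unless stated:

* `map_kummerLocalConditionAt_eq_of_unramifiedSubgroup_le` — **U / U ⇒ `H¹(f)(𝓛′) = 𝓛`**
  (`H¹(f)` maps `U′` into `U`, `X11b.Levels.map_mem_unramifiedSubgroup`, injectively with equal
  finite orders);
* `map_kummerLocalConditionAt_inf_eq_bot_of_unramifiedSubgroup_le_of_inertia_torsion` — **U / Λ ⇒
  `H¹(f)(𝓛′) ⊓ 𝓛 = ⊥`** (a common class pulls back by `H¹(g)`, `g = θ⁻¹|`, into `U′ ⊓ 𝓛′ = ⊥`);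
* `map_kummerLocalConditionAt_inf_eq_bot_of_inertia_torsion_of_unramifiedSubgroup_le` — **Λ / U ⇒
  `H¹(f)(𝓛′) ⊓ 𝓛 = ⊥`** (for ANY intertwining `f`);
* `map_kummerLocalConditionAt_eq_or_inf_eq_bot` — with `#E(K_v)[p] = p`: **`H¹(f)(𝓛′) = 𝓛` OR
  `𝓛 ⊓ H¹(f)(𝓛′) = ⊥`** (two subgroups of prime order; r1's `d_v ∈ {0, 1}`), and the Λ / Λ case is
  KIND (vii) (`map_kummerLocalConditionAt_eq_of_inertia_torsion`, FILE 2c: then `= 𝓛`).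

The READING "Λ-type ⟺ `p ∣ c_v`" (Tate's algorithm / component groups) is NOT asserted here: the
types enter as the theorem-shaped hypotheses `U ≤ 𝓛` / `hI`, to be discharged per reduction type by
the tree's suppliers (good: `SelmerLocalConditionGoodReduction*`; additive: `Additive.InertialTorsionAdditive`;
multiplicative: the cell's T-NSK / split-multiplicative witness files).

References: cells/n1011/ROUTE-1.md §44 (planner r1, GEN 32: L44, ST-44a); [MazurRubin2004] B. Mazur,
K. Rubin, *Kolyvagin systems*, §2.3 (comparison of local conditions); B. Mazur, K. Rubin, *Selmer
companion curves*, Trans. AMS 367 (2015), §3 (local conditions of congruent curves at places of bad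
reduction); [MilneADT2006] Ch. I Lemma 2.9, Lemma 3.3, Prop. 3.8.
-/

noncomputable section

open scoped Classical ContRepresentation
open CategoryTheory Function
open Field NumberField IsDedekindDomain WeierstrassCurve
open Literature.NumberTheory.EllipticCurves Literature.NumberTheory.GaloisRepresentations

namespace Summit.BirchSwinnertonDyer.Rank1Residual.GaloisImage

namespace TwoLagrangianLines

section PairRule

variable {K : Type} [Field K] [NumberField K] (W W' : WeierstrassCurve K) [W.IsElliptic]
  [W'.IsElliptic] (v : HeightOneSpectrum (𝓞 K)) {p : ℕ} [hp : Fact p.Prime]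

/-- **U / U ⇒ the local Kummer conditions correspond.** At a finite place `v ∤ p`, if the
unramified subgroup is contained in the local Kummer condition for BOTH `E` and `E′` (then both
inclusions are equalities, the two groups having the same finite order
`natCard_unramifiedSubgroup_eq_natCard_kummerLocalConditionAt`), then for the restriction `f` of a
`Γ_K`-isomorphism `θ : E′[p] ≃ E[p]`: `H¹(f)(𝓛_v(E′)) = 𝓛_v(E)` — `H¹(f)` maps unramified classes to
unramified classes (`X11b.Levels.map_mem_unramifiedSubgroup`), injectively
(`NonsplitKummer.map_injective_of_leftInverse`), onto by counting
(`NonsplitKummer.natCard_kummerLocalConditionAt_eq_of_congr`). No count hypothesis on `E(K_v)[p]`.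
[cite: MilneADT2006, Ch. I, Lemma 2.9 and Lemma 3.3] [cite: MazurRubin2004, §2.3] -/
theorem map_kummerLocalConditionAt_eq_of_unramifiedSubgroup_le (hpv : (p : 𝓞 K) ∉ v.asIdeal)
    (θ : geomTorsion W' (p : ℤ) ≃+ geomTorsion W (p : ℤ))
    (hθ : ∀ (σ : absoluteGaloisGroup K) (P : geomTorsion W' (p : ℤ)), θ (σ • P) = σ • θ P)
    (f : (GaloisRep.restrictField (v.adicCompletion K)
        (W'.torsionGaloisModule (p : ℤ))).toContRepresentation →ⁱL
      (GaloisRep.restrictField (v.adicCompletion K)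
        (W.torsionGaloisModule (p : ℤ))).toContRepresentation)
    (hf : ∀ x, f x = θ x)
    (hU : DiscreteGaloisModule.unramifiedSubgroup
        (GaloisRep.restrictField (v.adicCompletion K) (W.torsionGaloisModule (p : ℤ))) 1 ≤
      W.kummerLocalConditionAt (p : ℤ) (v.adicCompletion K))
    (hU' : DiscreteGaloisModule.unramifiedSubgroup
        (GaloisRep.restrictField (v.adicCompletion K) (W'.torsionGaloisModule (p : ℤ))) 1 ≤
      W'.kummerLocalConditionAt (p : ℤ) (v.adicCompletion K)) :
    (W'.kummerLocalConditionAt (p : ℤ) (v.adicCompletion K)).map (galoisCohomology.map f 1) =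
      W.kummerLocalConditionAt (p : ℤ) (v.adicCompletion K) := by
  have hp0 : p ≠ 0 := hp.out.ne_zero
  haveI : CharZero (v.adicCompletion K) := charZero_adicCompletion v
  haveI hfinL : Finite (W.kummerLocalConditionAt (p : ℤ) (v.adicCompletion K)) :=
    W.finite_kummerLocalConditionAt_adicCompletion v hp0
  haveI hfinL' : Finite (W'.kummerLocalConditionAt (p : ℤ) (v.adicCompletion K)) :=
    W'.finite_kummerLocalConditionAt_adicCompletion v hp0
  haveI : Finite (DiscreteGaloisModule.unramifiedSubgroup
      (GaloisRep.restrictField (v.adicCompletion K) (W.torsionGaloisModule (p : ℤ))) 1) :=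
    Nat.finite_of_card_ne_zero (by
      rw [W.natCard_unramifiedSubgroup_eq_natCard_kummerLocalConditionAt v hpv]; exact Nat.card_pos.ne')
  haveI : Finite (DiscreteGaloisModule.unramifiedSubgroup
      (GaloisRep.restrictField (v.adicCompletion K) (W'.torsionGaloisModule (p : ℤ))) 1) :=
    Nat.finite_of_card_ne_zero (by
      rw [W'.natCard_unramifiedSubgroup_eq_natCard_kummerLocalConditionAt v hpv]; exact Nat.card_pos.ne')
  -- `U = 𝓛`, `U′ = 𝓛′` (inclusion + equal finite orders)
  have hUeq := AddSubgroup.eq_of_le_of_card_ge hU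
    (le_of_eq (W.natCard_unramifiedSubgroup_eq_natCard_kummerLocalConditionAt v hpv).symm)
  have hU'eq := AddSubgroup.eq_of_le_of_card_ge hU'
    (le_of_eq (W'.natCard_unramifiedSubgroup_eq_natCard_kummerLocalConditionAt v hpv).symm)
  -- the inverse intertwining map and injectivity of `H¹(f)`
  have hθ' : ∀ (σ : absoluteGaloisGroup K) (P : geomTorsion W (p : ℤ)),
      θ.symm (σ • P) = σ • θ.symm P := fun σ P ↦ by
    apply θ.injective
    rw [AddEquiv.apply_symm_apply, hθ, AddEquiv.apply_symm_apply]
  let gθ : (W.torsionGaloisModule (p : ℤ)).toContRepresentation →ⁱL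
      (W'.torsionGaloisModule (p : ℤ)).toContRepresentation :=
    { toContinuousLinearMap := ⟨θ.symm.toAddMonoidHom.toIntLinearMap,
        continuous_of_discreteTopology⟩
      isIntertwining' := fun σ ↦ ContinuousLinearMap.ext fun P ↦ hθ' σ P }
  set g := gθ.restrictField (v.adicCompletion K) with hg
  have hgf : ∀ x, g (f x) = x := fun x ↦ by
    change θ.symm (f x) = x
    rw [hf, AddEquiv.symm_apply_apply]
  have hinj : Function.Injective (galoisCohomology.map f 1) :=
    NonsplitKummer.map_injective_of_leftInverse W' W f g hgf
  -- `H¹(f)(U′) ≤ U`, with the same finite order: equality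
  rw [← hU'eq, ← hUeq]
  refine AddSubgroup.eq_of_le_of_card_ge ?_ ?_
  · rintro _ ⟨x', hx', rfl⟩
    exact X11b.Levels.map_mem_unramifiedSubgroup f hx'
  · rw [hUeq, hU'eq, ← Nat.card_congr ((W'.kummerLocalConditionAt (p : ℤ)
        (v.adicCompletion K)).equivMapOfInjective _ hinj).toEquiv,
      ← NonsplitKummer.natCard_kummerLocalConditionAt_eq_of_congr W W' v θ hθ]

/-- **U / Λ ⇒ the local Kummer conditions are TRANSVERSE.** At `v ∤ p`: if `H¹_ur ≤ 𝓛_v(E)`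
(U-type) while every inertia-fixed point of `E′[p^∞]` is killed by `p` (`hI′`, Λ-type:
`H¹_ur ⊓ 𝓛_v(E′) = ⊥`, `Additive.unramifiedSubgroup_inf_kummerLocalConditionAt_eq_bot_of_inertia_torsion`),
then `H¹(f)(𝓛_v(E′)) ⊓ 𝓛_v(E) = ⊥` for the restriction `f` of `θ : E′[p] ≃ E[p]`: a common class
`H¹(f) x′ ∈ 𝓛 = H¹_ur` pulls back along `g = θ⁻¹|` to `x′ ∈ H¹_ur ⊓ 𝓛′ = ⊥`. With `#E(K_v)[p] = p`
this is r1's "cost EXACTLY 1" (`𝓛.relIndex (H¹(f) 𝓛′) = p`). [cite: MazurRubin2004, §2.3]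
[cite: MilneADT2006, Ch. I, Prop. 3.8] -/
theorem map_kummerLocalConditionAt_inf_eq_bot_of_unramifiedSubgroup_le_of_inertia_torsion
    (hpv : (p : 𝓞 K) ∉ v.asIdeal)
    (θ : geomTorsion W' (p : ℤ) ≃+ geomTorsion W (p : ℤ))
    (hθ : ∀ (σ : absoluteGaloisGroup K) (P : geomTorsion W' (p : ℤ)), θ (σ • P) = σ • θ P)
    (f : (GaloisRep.restrictField (v.adicCompletion K)
        (W'.torsionGaloisModule (p : ℤ))).toContRepresentation →ⁱL
      (GaloisRep.restrictField (v.adicCompletion K)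
        (W.torsionGaloisModule (p : ℤ))).toContRepresentation)
    (hf : ∀ x, f x = θ x)
    (hU : DiscreteGaloisModule.unramifiedSubgroup
        (GaloisRep.restrictField (v.adicCompletion K) (W.torsionGaloisModule (p : ℤ))) 1 ≤
      W.kummerLocalConditionAt (p : ℤ) (v.adicCompletion K))
    (hI' : ∀ Q : W'.geomPrimaryTorsion p,
      (∀ τ ∈ absInertia (v.adicCompletion K),
        GaloisRep.restrictField (v.adicCompletion K) (X11b.LocBridge.primaryGaloisModule W' p) τ Q = Q) →
      p • Q = 0) :
    (W'.kummerLocalConditionAt (p : ℤ) (v.adicCompletion K)).map (galoisCohomology.map f 1) ⊓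
      W.kummerLocalConditionAt (p : ℤ) (v.adicCompletion K) = ⊥ := by
  have hp0 : p ≠ 0 := hp.out.ne_zero
  haveI : CharZero (v.adicCompletion K) := charZero_adicCompletion v
  haveI hfinL : Finite (W.kummerLocalConditionAt (p : ℤ) (v.adicCompletion K)) :=
    W.finite_kummerLocalConditionAt_adicCompletion v hp0
  haveI : Finite (DiscreteGaloisModule.unramifiedSubgroup
      (GaloisRep.restrictField (v.adicCompletion K) (W.torsionGaloisModule (p : ℤ))) 1) :=
    Nat.finite_of_card_ne_zero (by
      rw [W.natCard_unramifiedSubgroup_eq_natCard_kummerLocalConditionAt v hpv]; exact Nat.card_pos.ne')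
  have hUeq := AddSubgroup.eq_of_le_of_card_ge hU
    (le_of_eq (W.natCard_unramifiedSubgroup_eq_natCard_kummerLocalConditionAt v hpv).symm)
  have hθ' : ∀ (σ : absoluteGaloisGroup K) (P : geomTorsion W (p : ℤ)),
      θ.symm (σ • P) = σ • θ.symm P := fun σ P ↦ by
    apply θ.injective
    rw [AddEquiv.apply_symm_apply, hθ, AddEquiv.apply_symm_apply]
  let gθ : (W.torsionGaloisModule (p : ℤ)).toContRepresentation →ⁱL
      (W'.torsionGaloisModule (p : ℤ)).toContRepresentation :=
    { toContinuousLinearMap := ⟨θ.symm.toAddMonoidHom.toIntLinearMap,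
        continuous_of_discreteTopology⟩
      isIntertwining' := fun σ ↦ ContinuousLinearMap.ext fun P ↦ hθ' σ P }
  set g := gθ.restrictField (v.adicCompletion K) with hg
  have hgf : ∀ x, g (f x) = x := fun x ↦ by
    change θ.symm (f x) = x
    rw [hf, AddEquiv.symm_apply_apply]
  have hbot' := Additive.unramifiedSubgroup_inf_kummerLocalConditionAt_eq_bot_of_inertia_torsion
    W' p v hpv hI'
  rw [eq_bot_iff]
  rintro x ⟨⟨x', hx', rfl⟩, hxL⟩
  rw [← hUeq] at hxL
  have hx'U : x' ∈ DiscreteGaloisModule.unramifiedSubgroup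
      (GaloisRep.restrictField (v.adicCompletion K) (W'.torsionGaloisModule (p : ℤ))) 1 := by
    rw [← map_map_eq_self_of_leftInverse W W' f g hgf x']
    exact X11b.Levels.map_mem_unramifiedSubgroup g hxL
  have hx'0 : x' = 0 := by
    have hmem : x' ∈ DiscreteGaloisModule.unramifiedSubgroup
        (GaloisRep.restrictField (v.adicCompletion K) (W'.torsionGaloisModule (p : ℤ))) 1 ⊓
        W'.kummerLocalConditionAt (p : ℤ) (v.adicCompletion K) := ⟨hx'U, hx'⟩
    rw [hbot'] at hmem
    exact (AddSubgroup.mem_bot).mp hmem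
  rw [AddSubgroup.mem_bot, hx'0, map_zero]

/-- **Λ / U ⇒ the local Kummer conditions are TRANSVERSE** (the mirror case): at `v ∤ p`, if
`hI` holds for `E` (so `H¹_ur ⊓ 𝓛_v(E) = ⊥`) and `H¹_ur ≤ 𝓛_v(E′)` (so `= `), then for EVERY
continuous intertwining `f : E′[p]| → E[p]|`, `H¹(f)(𝓛_v(E′)) ⊓ 𝓛_v(E) = ⊥` (`H¹(f)(H¹_ur) ≤ H¹_ur`).
[cite: MazurRubin2004, §2.3] [cite: MilneADT2006, Ch. I, Prop. 3.8] -/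
theorem map_kummerLocalConditionAt_inf_eq_bot_of_inertia_torsion_of_unramifiedSubgroup_le
    (hpv : (p : 𝓞 K) ∉ v.asIdeal)
    (f : (GaloisRep.restrictField (v.adicCompletion K)
        (W'.torsionGaloisModule (p : ℤ))).toContRepresentation →ⁱL
      (GaloisRep.restrictField (v.adicCompletion K)
        (W.torsionGaloisModule (p : ℤ))).toContRepresentation)
    (hI : ∀ Q : W.geomPrimaryTorsion p,
      (∀ τ ∈ absInertia (v.adicCompletion K),
        GaloisRep.restrictField (v.adicCompletion K) (X11b.LocBridge.primaryGaloisModule W p) τ Q = Q) →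
      p • Q = 0)
    (hU' : DiscreteGaloisModule.unramifiedSubgroup
        (GaloisRep.restrictField (v.adicCompletion K) (W'.torsionGaloisModule (p : ℤ))) 1 ≤
      W'.kummerLocalConditionAt (p : ℤ) (v.adicCompletion K)) :
    (W'.kummerLocalConditionAt (p : ℤ) (v.adicCompletion K)).map (galoisCohomology.map f 1) ⊓
      W.kummerLocalConditionAt (p : ℤ) (v.adicCompletion K) = ⊥ := by
  have hp0 : p ≠ 0 := hp.out.ne_zero
  haveI : CharZero (v.adicCompletion K) := charZero_adicCompletion v
  haveI hfinL' : Finite (W'.kummerLocalConditionAt (p : ℤ) (v.adicCompletion K)) :=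
    W'.finite_kummerLocalConditionAt_adicCompletion v hp0
  haveI : Finite (DiscreteGaloisModule.unramifiedSubgroup
      (GaloisRep.restrictField (v.adicCompletion K) (W'.torsionGaloisModule (p : ℤ))) 1) :=
    Nat.finite_of_card_ne_zero (by
      rw [W'.natCard_unramifiedSubgroup_eq_natCard_kummerLocalConditionAt v hpv]; exact Nat.card_pos.ne')
  have hU'eq := AddSubgroup.eq_of_le_of_card_ge hU'
    (le_of_eq (W'.natCard_unramifiedSubgroup_eq_natCard_kummerLocalConditionAt v hpv).symm)
  have hbot := Additive.unramifiedSubgroup_inf_kummerLocalConditionAt_eq_bot_of_inertia_torsion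
    W p v hpv hI
  rw [eq_bot_iff]
  rintro x ⟨⟨x', hx', rfl⟩, hxL⟩
  rw [← hU'eq] at hx'
  have hxU := X11b.Levels.map_mem_unramifiedSubgroup f hx'
  have hmem : galoisCohomology.map f 1 x' ∈ DiscreteGaloisModule.unramifiedSubgroup
      (GaloisRep.restrictField (v.adicCompletion K) (W.torsionGaloisModule (p : ℤ))) 1 ⊓
      W.kummerLocalConditionAt (p : ℤ) (v.adicCompletion K) := ⟨hxU, hxL⟩
  rwa [hbot] at hmem

/-- **`d_v ∈ {0, 1}`: with ONE rational line of `p`-torsion the transported Kummer line and the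
Kummer line COINCIDE or are TRANSVERSE.** At `v ∤ p` with `#E(K_v)[p] = p`, both `𝓛_v(E)` and
`H¹(f)(𝓛_v(E′))` have prime order `p` (`natCard_kummerLocalConditionAt_adicCompletion`,
`NonsplitKummer.natCard_kummerLocalConditionAt_eq_of_congr`, injectivity of `H¹(f)`), so they are
equal or meet trivially (`LagrangianDichotomy.eq_or_inf_eq_bot_of_card_eq_prime`). Route planner 1's
L44 (ROUTE-1 §44): at such places the comparison index is `1` or `p`, never in between.
[cite: MazurRubin2004, §2.3] -/
theorem map_kummerLocalConditionAt_eq_or_inf_eq_bot (hpv : (p : 𝓞 K) ∉ v.asIdeal)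
    (θ : geomTorsion W' (p : ℤ) ≃+ geomTorsion W (p : ℤ))
    (hθ : ∀ (σ : absoluteGaloisGroup K) (P : geomTorsion W' (p : ℤ)), θ (σ • P) = σ • θ P)
    (hcard : Nat.card (nsmulAddMonoidHom p :
      (W.baseChange (v.adicCompletion K)).toAffine.Point →+ _).ker = p)
    (f : (GaloisRep.restrictField (v.adicCompletion K)
        (W'.torsionGaloisModule (p : ℤ))).toContRepresentation →ⁱL
      (GaloisRep.restrictField (v.adicCompletion K)
        (W.torsionGaloisModule (p : ℤ))).toContRepresentation)
    (hf : ∀ x, f x = θ x) :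
    (W'.kummerLocalConditionAt (p : ℤ) (v.adicCompletion K)).map (galoisCohomology.map f 1) =
        W.kummerLocalConditionAt (p : ℤ) (v.adicCompletion K) ∨
      W.kummerLocalConditionAt (p : ℤ) (v.adicCompletion K) ⊓
        (W'.kummerLocalConditionAt (p : ℤ) (v.adicCompletion K)).map (galoisCohomology.map f 1) =
        ⊥ := by
  have hp0 : p ≠ 0 := hp.out.ne_zero
  haveI : CharZero (v.adicCompletion K) := charZero_adicCompletion v
  have hθ' : ∀ (σ : absoluteGaloisGroup K) (P : geomTorsion W (p : ℤ)),
      θ.symm (σ • P) = σ • θ.symm P := fun σ P ↦ by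
    apply θ.injective
    rw [AddEquiv.apply_symm_apply, hθ, AddEquiv.apply_symm_apply]
  let gθ : (W.torsionGaloisModule (p : ℤ)).toContRepresentation →ⁱL
      (W'.torsionGaloisModule (p : ℤ)).toContRepresentation :=
    { toContinuousLinearMap := ⟨θ.symm.toAddMonoidHom.toIntLinearMap,
        continuous_of_discreteTopology⟩
      isIntertwining' := fun σ ↦ ContinuousLinearMap.ext fun P ↦ hθ' σ P }
  set g := gθ.restrictField (v.adicCompletion K) with hg
  have hgf : ∀ x, g (f x) = x := fun x ↦ by
    change θ.symm (f x) = x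
    rw [hf, AddEquiv.symm_apply_apply]
  have hinj : Function.Injective (galoisCohomology.map f 1) :=
    NonsplitKummer.map_injective_of_leftInverse W' W f g hgf
  have hLcard : Nat.card (W.kummerLocalConditionAt (p : ℤ) (v.adicCompletion K)) = p := by
    rw [W.natCard_kummerLocalConditionAt_adicCompletion v hp0, hcard,
      natCard_quot_adicCompletionIntegers_eq_one hpv, mul_one]
  have hL'card : Nat.card (W'.kummerLocalConditionAt (p : ℤ) (v.adicCompletion K)) = p := by
    rw [← NonsplitKummer.natCard_kummerLocalConditionAt_eq_of_congr W W' v θ hθ]; exact hLcard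
  have hMcard : Nat.card ((W'.kummerLocalConditionAt (p : ℤ) (v.adicCompletion K)).map
      (galoisCohomology.map f 1)) = p :=
    (Nat.card_congr ((W'.kummerLocalConditionAt (p : ℤ)
      (v.adicCompletion K)).equivMapOfInjective _ hinj).toEquiv).symm.trans hL'card
  exact LagrangianDichotomy.eq_or_inf_eq_bot_of_card_eq_prime hp.out _ _ hLcard hMcard

end PairRule

end TwoLagrangianLines

end Summit.BirchSwinnertonDyer.Rank1Residual.GaloisImage

end
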